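import Mathlib.Analysis.Calculus.BumpFunction.InnerProduct
import Literature.Analysis.FluidPDE.StatisticalSolution
import Literature.Analysis.FluidPDE.StokesTorusProofs
import HarnessLib

/-!
# Cylindrical test functionals exist: the carrier `Torus.CylindricalTest d` is inhabited

`Literature.Analysis.FluidPDE.StatisticalSolution` bundles the **cylindrical test functionals**
`Φ(u) = φ((u,g₁), …, (u,gₘ))` of Foias–Manley–Rosa–Temam — `g₁, …, gₘ ∈ 𝒱̇_per` smooth,
divergence-free, mean-zero fields and `φ : ℝ^m → ℝ` a compactly supported `C¹` profile
(FMRT 2001, Ch. V §1.2 Def. 1.3, the class `𝒯̇_per`; Ch. IV §1.2 Def. 1.2 and the cylindrical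
example after (1.27)) — as the structure `Torus.CylindricalTest d` (data `m, g, φ` plus the
three field axioms and the two profile axioms). Route items of `Summits/AnomalousDissipation`
quantify over `Torus.CylindricalTest (Fin 3)`; this file records, by **explicit standard
inhabitants**, that the carrier is nonempty for *every* finite index type `d` (libB carrier
census; there is no empty parameter region).

## Contents (all proved, no named facts)

* `Torus.CylindricalTest.const d c` — the constant functional `Φ ≡ c`: no coordinates (`m = 0`)
  and the constant profile on `ℝ⁰` (a one-point space, so every profile is `C¹` with compact
  support); `eval_const : Φ(u) = c`, `grad_const : Φ'(u) = 0`. Inhabits `CylindricalTest d` for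
  every `d` (also `d = ∅` and `#d = 1`, where `𝒱̇_per = {0}` and no other inhabitant has a
  non-zero test field).
* `Torus.CylindricalTest.singleMode` — one coordinate along a **Stokes eigenfunction**
  `w = Torus.stokesMode k a c` (`x ↦ cos(2π k·x) a` / `x ↦ sin(2π k·x) a`, `k ≠ 0`, `k · a = 0`;
  FMRT 2001, Ch. II §6 (6.17)–(6.18): in the periodic case the eigenfunctions of the Stokes
  operator are these Fourier modes), with an arbitrary `C¹_c` profile `ψ` on `ℝ¹`:
  `Φ(u) = ψ((u, w))`, `Φ'(u) = ψ'((u, w)) w` (`grad_singleMode`). The fields are in `𝒱̇_per` by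
  `Torus.isSmooth_stokesMode`, `Torus.isDivFree_stokesMode`, `Torus.hasZeroMean_stokesMode`
  (`StokesTorusProofs`).
* `Torus.CylindricalTest.shearBump hij` (`i ≠ j : d`) — a fully explicit non-degenerate
  inhabitant: the shear mode `x ↦ cos(2π xᵢ) eⱼ` with Mathlib's standard smooth bump of `ℝ¹`
  centred at `0` as profile; its test field does not vanish (`shearBump_g_apply_zero`,
  `shearBump_g_ne_zero`).
* `Torus.CylindricalTest_nonempty : ∀ d, Nonempty (CylindricalTest d)` and the instances
  `Inhabited (CylindricalTest d)`, `Nonempty (CylindricalTest d)`.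

A further (Galerkin) inhabitant already in the tree is `Torus.galerkinTest`
(`StatisticalSolutionEnergyEq`, FMRT's `Φ(u) = ρ(|P_m u|²)`); it is not re-used here to keep the
import closure of this witness file small.

## Mathlib search

Used: `ContDiffBump` with `hasContDiffBump_of_innerProductSpace`, `ContDiffBump.contDiff`,
`ContDiffBump.hasCompactSupport`, `ContDiffBump.one_of_mem_closedBall`;
`HasCompactSupport.of_compactSpace`; `UnitAddTorus.mFourier_single`, `fourier_eval_zero`;
`EuclideanSpace.inner_single_left`, `PiLp.single_apply`. Nothing on statistical
solutions or cylindrical functionals exists in Mathlib (grep `cylindrical`, `StatisticalSolution`: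
nothing outside `Literature/`).

## References

* C. Foias, O. Manley, R. Rosa, R. Temam, *Navier–Stokes Equations and Turbulence*, Encyclopedia
  Math. Appl. 83, Cambridge Univ. Press (2001): Ch. V §1.2 Def. 1.3 (cylindrical test
  functionals `𝒯_per`, `𝒯̇_per`), Ch. IV §1.2 Def. 1.2; Ch. II §6 (6.16)–(6.18) (Stokes operator
  and its eigenfunctions in the periodic case). [FMRTTurbulence2001]
* P. Constantin, C. Foias, *Navier–Stokes Equations*, Univ. Chicago Press (1988), Ch. 4,
  (4.13)–(4.14), (4.33), (4.42) (the Stokes modes on the torus). [ConstantinFoias1988]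
-/

noncomputable section

open MeasureTheory UnitAddTorus
open scoped InnerProductSpace RealInnerProductSpace ContDiff

namespace Literature.Analysis.FluidPDE

namespace Torus

variable {d : Type*} [Fintype d] [DecidableEq d]

namespace CylindricalTest

/-! ### The constant functional `Φ ≡ c` (no coordinates) -/

variable (d) in
/-- The **constant cylindrical test functional** `Φ ≡ c`: `m = 0` coordinates (no test fields)
and the constant profile `φ ≡ c` on `ℝ⁰`; since `ℝ⁰` is a single point, `φ` is `C¹` with compact
support, so this is a member of FMRT's class `𝒯̇_per` for every index type `d` (FMRT 2001, Ch. V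
§1.2 Def. 1.3 with `k = 0`; its differential `Φ' = Σⱼ ∂ⱼφ gⱼ` is the empty sum `0`).
[cite: FMRTTurbulence2001, Ch. V §1.2 Def. 1.3 (the class of cylindrical test functionals)] -/
def const (c : ℝ) : CylindricalTest d where
  m := 0
  g i := Fin.elim0 i
  g_smooth i := Fin.elim0 i
  g_divFree i := Fin.elim0 i
  g_zeroMean i := Fin.elim0 i
  φ _ := c
  φ_contDiff := contDiff_const
  φ_compact := HasCompactSupport.of_compactSpace _

/-- The constant functional has no coordinates. [folklore] -/
@[simp]
theorem const_m (c : ℝ) : (const d c).m = 0 := rfl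

/-- The constant functional takes the value `c` everywhere: `Φ(u) = c`. [folklore] -/
@[simp]
theorem eval_const (c : ℝ) (u : FunctionSpaces.Torus.energySpace d) : (const d c).eval u = c := rfl

/-- The differential of the constant functional vanishes: `Φ'(u) = 0` (the empty sum).
[folklore] -/
@[simp]
theorem grad_const (c : ℝ) (u : FunctionSpaces.Torus.energySpace d) : (const d c).grad u = 0 := by
  funext x
  change ∑ i : Fin 0, (_root_.fderiv ℝ (const d c).φ ((const d c).coords u)
    (EuclideanSpace.single i 1)) • (const d c).g i x = 0
  simp

/-! ### One coordinate along a Stokes eigenfunction -/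

/-- The **single-mode cylindrical test functional** `Φ(u) = ψ((u, w))` with one test field, the
Stokes eigenfunction `w = stokesMode k a c` (`x ↦ cos(2π k·x) a` for `c = true`,
`x ↦ sin(2π k·x) a` for `c = false`) of non-zero frequency `k ∈ ℤ^d` and transversal amplitude
`k · a = 0`, and an arbitrary compactly supported `C¹` profile `ψ` on `ℝ¹`. In the periodic case
the eigenfunctions of the Stokes operator are exactly these Fourier modes (FMRT 2001, Ch. II §6
(6.17)–(6.18)), and `w ∈ 𝒱̇_per` (smooth, divergence free, mean zero:
`Torus.isSmooth_stokesMode`, `Torus.isDivFree_stokesMode`, `Torus.hasZeroMean_stokesMode`), so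
`Φ ∈ 𝒯̇_per` (FMRT 2001, Ch. V §1.2 Def. 1.3 with `k = 1`).
[cite: FMRTTurbulence2001, Ch. V §1.2 Def. 1.3 and Ch. II §6 (6.17)–(6.18)] -/
def singleMode {k : d → ℤ} (hk : k ≠ 0) {a : EuclideanSpace ℝ d}
    (hka : ⟪FunctionSpaces.Torus.latticeVec k, a⟫_ℝ = 0) (c : Bool)
    (ψ : EuclideanSpace ℝ (Fin 1) → ℝ) (hψ : ContDiff ℝ 1 ψ) (hψc : HasCompactSupport ψ) :
    CylindricalTest d where
  m := 1
  g _ := stokesMode k a c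
  g_smooth _ := isSmooth_stokesMode k a c
  g_divFree _ := isDivFree_stokesMode hka c
  g_zeroMean _ := hasZeroMean_stokesMode hk a c
  φ := ψ
  φ_contDiff := hψ
  φ_compact := hψc

section SingleMode

variable {k : d → ℤ} (hk : k ≠ 0) {a : EuclideanSpace ℝ d}
  (hka : ⟪FunctionSpaces.Torus.latticeVec k, a⟫_ℝ = 0) (c : Bool)
  (ψ : EuclideanSpace ℝ (Fin 1) → ℝ) (hψ : ContDiff ℝ 1 ψ) (hψc : HasCompactSupport ψ)

/-- The single-mode functional has one coordinate. [folklore] -/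
@[simp]
theorem singleMode_m : (singleMode hk hka c ψ hψ hψc).m = 1 := rfl

/-- The test field of the single-mode functional is the Stokes mode. [folklore] -/
@[simp]
theorem singleMode_g (i : Fin (singleMode hk hka c ψ hψ hψc).m) :
    (singleMode hk hka c ψ hψ hψc).g i = stokesMode k a c := rfl

/-- The profile of the single-mode functional. [folklore] -/
@[simp]
theorem singleMode_φ : (singleMode hk hka c ψ hψ hψc).φ = ψ := rfl

/-- The coordinate of `u` is its pairing with the Stokes mode: `(u, w)`. [folklore] -/
theorem singleMode_coords_apply (u : FunctionSpaces.Torus.energySpace d)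
    (i : Fin (singleMode hk hka c ψ hψ hψc).m) :
    (singleMode hk hka c ψ hψ hψc).coords u i =
      pairing (u : Lp (EuclideanSpace ℝ d) 2 (volume : Measure (UnitAddTorus d)))
        (stokesMode k a c) := rfl

/-- `Φ(u) = ψ((u, w))`. [folklore] -/
theorem eval_singleMode (u : FunctionSpaces.Torus.energySpace d) :
    (singleMode hk hka c ψ hψ hψc).eval u = ψ ((singleMode hk hka c ψ hψ hψc).coords u) := rfl

/-- `Φ'(u) = ψ'((u, w)) w`: the differential of the single-mode functional is a multiple of the
Stokes mode (FMRT 2001, Ch. V §1.2, display after Def. 1.3: `Φ'(u) = Σⱼ ∂ⱼφ gⱼ`).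
[cite: FMRTTurbulence2001, Ch. V §1.2, display after Def. 1.3] -/
theorem grad_singleMode (u : FunctionSpaces.Torus.energySpace d) :
    (singleMode hk hka c ψ hψ hψc).grad u = fun x =>
      (_root_.fderiv ℝ ψ ((singleMode hk hka c ψ hψ hψc).coords u)
        (EuclideanSpace.single 0 1)) • stokesMode k a c x := by
  funext x
  change ∑ i : Fin 1, (_root_.fderiv ℝ ψ ((singleMode hk hka c ψ hψ hψc).coords u)
    (EuclideanSpace.single i 1)) • stokesMode k a c x = _
  rw [Fin.sum_univ_one]

end SingleMode

/-! ### A fully explicit inhabitant: a shear mode with a bump profile -/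

/-- The standard smooth bump of `ℝ¹` centred at `0` (Mathlib's default `ContDiffBump`: equal to
`1` on the closed unit ball, supported in the ball of radius `2`). [folklore] -/
def bumpProfile : ContDiffBump (0 : EuclideanSpace ℝ (Fin 1)) := default

omit [Fintype d] in
/-- The unit frequency `eᵢ ∈ ℤ^d` is non-zero. [folklore] -/
theorem single_one_ne_zero (i : d) : (Pi.single i 1 : d → ℤ) ≠ 0 :=
  Function.ne_iff.2 ⟨i, by simp⟩

/-- For `i ≠ j` the amplitude `eⱼ` is transversal to the frequency `eᵢ`: `eᵢ · eⱼ = 0`. [folklore] -/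
theorem inner_latticeVec_single_single {i j : d} (hij : i ≠ j) :
    ⟪FunctionSpaces.Torus.latticeVec (Pi.single i 1 : d → ℤ), EuclideanSpace.single j (1 : ℝ)⟫_ℝ = 0 := by
  rw [FunctionSpaces.Torus.latticeVec_single, EuclideanSpace.inner_single_left,
    PiLp.single_apply, if_neg hij, mul_zero]

/-- The **shear-mode cylindrical test functional** for two distinct directions `i ≠ j`: one
coordinate along the shear Stokes eigenfunction `x ↦ cos(2π xᵢ) eⱼ`
(`stokesMode eᵢ eⱼ true`; frequency `eᵢ ≠ 0`, amplitude `eⱼ ⊥ eᵢ`) and the standard bump of `ℝ¹`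
as profile: `Φ(u) = bump((u, cos(2π xᵢ) eⱼ))`. A non-degenerate member of `𝒯̇_per` available as
soon as `d` has two distinct indices (FMRT 2001, Ch. V §1.2 Def. 1.3; Ch. II §6 (6.17)).
[cite: FMRTTurbulence2001, Ch. V §1.2 Def. 1.3 and Ch. II §6 (6.17)–(6.18)] -/
def shearBump {i j : d} (hij : i ≠ j) : CylindricalTest d :=
  singleMode (single_one_ne_zero i) (inner_latticeVec_single_single hij) true bumpProfile
    bumpProfile.contDiff bumpProfile.hasCompactSupport

section ShearBump

variable {i j : d} (hij : i ≠ j)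

/-- The shear functional has one coordinate. [folklore] -/
@[simp]
theorem shearBump_m : (shearBump hij).m = 1 := rfl

/-- The test field of the shear functional is the shear mode `x ↦ cos(2π xᵢ) eⱼ`. [folklore] -/
theorem shearBump_g_apply (l : Fin (shearBump hij).m) (x : UnitAddTorus d) :
    (shearBump hij).g l x = (fourier 1 (x i)).re • EuclideanSpace.single j (1 : ℝ) := by
  change stokesMode (Pi.single i 1) (EuclideanSpace.single j 1) true x = _
  rw [stokesMode_apply, if_pos rfl, mFourier_single]

/-- At the origin the shear mode equals `eⱼ` (`cos 0 = 1`). [folklore] -/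
theorem shearBump_g_apply_zero (l : Fin (shearBump hij).m) :
    (shearBump hij).g l 0 = EuclideanSpace.single j (1 : ℝ) := by
  rw [shearBump_g_apply, Pi.zero_apply, fourier_eval_zero, Complex.one_re, one_smul]

/-- The test field of the shear functional is not the zero field: the inhabitant is
non-degenerate. [folklore] -/
theorem shearBump_g_ne_zero (l : Fin (shearBump hij).m) : (shearBump hij).g l ≠ 0 := by
  intro h
  have h0 := congrArg (fun g : UnitAddTorus d → EuclideanSpace ℝ d => g 0 j) h
  simp [shearBump_g_apply_zero] at h0

/-- The profile of the shear functional is the standard bump, equal to `1` at the origin, so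
`Φ(u) = 1` whenever `(u, cos(2π xᵢ) eⱼ)` lies in the closed unit ball. [folklore] -/
theorem shearBump_φ_zero : (shearBump hij).φ 0 = 1 := by
  change (bumpProfile : EuclideanSpace ℝ (Fin 1) → ℝ) 0 = 1
  exact bumpProfile.one_of_mem_closedBall (Metric.mem_closedBall_self bumpProfile.rIn_pos.le)

end ShearBump

end CylindricalTest

/-! ### The carrier is nonempty -/

/-- **Cylindrical test functionals exist** for every finite index type `d`: the constant
functional `CylindricalTest.const d 0` (no coordinates) inhabits `Torus.CylindricalTest d`
(FMRT 2001, Ch. V §1.2 Def. 1.3). Non-degenerate inhabitants: `CylindricalTest.singleMode`,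
`CylindricalTest.shearBump` (two distinct indices), `Torus.galerkinTest`
(`StatisticalSolutionEnergyEq`). libB carrier census: no empty parameter region.
[cite: FMRTTurbulence2001, Ch. V §1.2 Def. 1.3] -/
theorem CylindricalTest_nonempty :
    ∀ (ι : Type*) [Fintype ι] [DecidableEq ι], Nonempty (CylindricalTest ι) :=
  fun ι _ _ => ⟨CylindricalTest.const ι 0⟩

/-- `Torus.CylindricalTest d` is inhabited by the constant functional `Φ ≡ 0`. [folklore] -/
instance CylindricalTest.instInhabited : Inhabited (CylindricalTest d) :=
  ⟨CylindricalTest.const d 0⟩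

/-- `Torus.CylindricalTest d` is nonempty (registered for the carrier census). [folklore] -/
instance CylindricalTest.instNonempty : Nonempty (CylindricalTest d) :=
  CylindricalTest_nonempty d

end Torus

end Literature.Analysis.FluidPDE
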